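import Summits.Ventures.PercRepro.TheoremNAll
import Summits.Ventures.PercRepro.LineLadderArith
import Summits.Ventures.PercRepro.MatroidTruncate

/-!
# PercRepro — C-025 on the LINE LADDER: the matroid bridge (p9, gen 13)

`proofs/P9-S4-LINELADDER-g13.md` Lemma 1 in the tree's vocabulary. A finite matroid `M` on `E = L ⊔ F` whose rank
function is `ρ(X) = min p (min |X ∩ L| 2 + |X ∩ F|)` (`|L| = 3`, `|F| = m`: the line ladder `T_p(U_{2,3} ⊕ U_{m,m})`)
has `#U(p,q) = 4·C(m,q−2) + 3·C(m,q−1) + C(m,q)` and `#Y(p,q)` the three-sum of LineLadderArith, so `RLS M p q`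
follows from `ladder_ineq`. The counting goes through the fibres `{A ⊆ E : |A ∩ L| = k, |A ∩ F| = a}` of size
`C(|L|, k)·C(|F|, a)` (`ncard_fibre`) and the fibrewise decomposition of any family defined by a predicate on
`(|A ∩ L|, |A ∩ F|)` (`ncard_setOf_fibre`).
-/

namespace PercRepro.LineLadder

open Set Finset

variable {α : Type}

/-- **The fibre count**: for finite disjoint `L`, `F`, the subsets `A ⊆ L ∪ F` with `|A ∩ L| = k` and `|A ∩ F| = a`
number `C(|L|, k)·C(|F|, a)`. -/
theorem ncard_fibre {L F : Set α} (hL : L.Finite) (hF : F.Finite) (hLF : Disjoint L F) (k a : ℕ) :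
    {A : Set α | A ⊆ L ∪ F ∧ (A ∩ L).ncard = k ∧ (A ∩ F).ncard = a}.ncard
      = L.ncard.choose k * F.ncard.choose a := by
  set P : Set (Set α × Set α) := {X | X ⊆ L ∧ X.ncard = k} ×ˢ {B | B ⊆ F ∧ B.ncard = a} with hP
  have himg : {A : Set α | A ⊆ L ∪ F ∧ (A ∩ L).ncard = k ∧ (A ∩ F).ncard = a}
      = (fun XB : Set α × Set α => XB.1 ∪ XB.2) '' P := by
    ext A
    simp only [mem_setOf_eq, mem_image, hP, mem_prod, Prod.exists]
    constructor
    · rintro ⟨hAE, hk, ha⟩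
      refine ⟨A ∩ L, A ∩ F, ⟨⟨inter_subset_right, hk⟩, ⟨inter_subset_right, ha⟩⟩, ?_⟩
      rw [← inter_union_distrib_left, inter_eq_left.2 hAE]
    · rintro ⟨X, B, ⟨⟨hXL, hXk⟩, ⟨hBF, hBa⟩⟩, rfl⟩
      have hXF : X ∩ F = ∅ := disjoint_iff_inter_eq_empty.1 ((hLF.mono_left hXL))
      have hBL : B ∩ L = ∅ := disjoint_iff_inter_eq_empty.1 ((hLF.symm.mono_left hBF))
      refine ⟨union_subset_union hXL hBF, ?_, ?_⟩
      · rw [union_inter_distrib_right, inter_eq_left.2 hXL, hBL, union_empty, hXk]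
      · rw [union_inter_distrib_right, hXF, empty_union, inter_eq_left.2 hBF, hBa]
  have hinj : Set.InjOn (fun XB : Set α × Set α => XB.1 ∪ XB.2) P := by
    rintro ⟨X, B⟩ ⟨⟨hXL, -⟩, ⟨hBF, -⟩⟩ ⟨X', B'⟩ ⟨⟨hXL', -⟩, ⟨hBF', -⟩⟩ hXB
    simp only at hXB
    have hXF : X ∩ F = ∅ := disjoint_iff_inter_eq_empty.1 ((hLF.mono_left hXL))
    have hBL : B ∩ L = ∅ := disjoint_iff_inter_eq_empty.1 ((hLF.symm.mono_left hBF))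
    have hXF' : X' ∩ F = ∅ := disjoint_iff_inter_eq_empty.1 ((hLF.mono_left hXL'))
    have hBL' : B' ∩ L = ∅ := disjoint_iff_inter_eq_empty.1 ((hLF.symm.mono_left hBF'))
    have e1 : X = (X ∪ B) ∩ L := by
      rw [union_inter_distrib_right, inter_eq_left.2 hXL, hBL, union_empty]
    have e2 : X' = (X' ∪ B') ∩ L := by
      rw [union_inter_distrib_right, inter_eq_left.2 hXL', hBL', union_empty]
    have e3 : B = (X ∪ B) ∩ F := by
      rw [union_inter_distrib_right, hXF, empty_union, inter_eq_left.2 hBF]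
    have e4 : B' = (X' ∪ B') ∩ F := by
      rw [union_inter_distrib_right, hXF', empty_union, inter_eq_left.2 hBF']
    have hX : X = X' := calc
      X = (X ∪ B) ∩ L := e1
      _ = (X' ∪ B') ∩ L := by rw [hXB]
      _ = X' := e2.symm
    have hB : B = B' := calc
      B = (X ∪ B) ∩ F := e3
      _ = (X' ∪ B') ∩ F := by rw [hXB]
      _ = B' := e4.symm
    rw [hX, hB]
  rw [himg, hinj.ncard_image, hP, Set.ncard_prod, Set.ncard_powerset_ncard hL, Set.ncard_powerset_ncard hF]

/-- **Fibrewise counting**: a family of subsets of `L ⊔ F` cut out by a predicate on `(|A ∩ L|, |A ∩ F|)` has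
`Σ_k Σ_a [P k a]·C(|L|, k)·C(|F|, a)` members. -/
theorem ncard_setOf_fibre {L F : Set α} (hL : L.Finite) (hF : F.Finite) (hLF : Disjoint L F)
    (P : ℕ → ℕ → Prop) [DecidableRel P] :
    {A : Set α | A ⊆ L ∪ F ∧ P (A ∩ L).ncard (A ∩ F).ncard}.ncard
      = ∑ k ∈ range (L.ncard + 1), ∑ a ∈ range (F.ncard + 1),
          if P k a then L.ncard.choose k * F.ncard.choose a else 0 := by
  classical
  set T := {A : Set α | A ⊆ L ∪ F ∧ P (A ∩ L).ncard (A ∩ F).ncard} with hTdef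
  have hT : T.Finite := (hL.union hF).finite_subsets.subset fun A hA => hA.1
  set f : Set α → ℕ × ℕ := fun A => ((A ∩ L).ncard, (A ∩ F).ncard) with hfdef
  set S : Finset (ℕ × ℕ) := range (L.ncard + 1) ×ˢ range (F.ncard + 1) with hSdef
  have hmaps : Set.MapsTo f (hT.toFinset : Set (Set α)) (S : Set (ℕ × ℕ)) := by
    intro A hA
    simp only [hSdef, Finset.coe_product, Finset.coe_range, Set.mem_prod, Set.mem_Iio, hfdef]
    exact ⟨Nat.lt_succ_of_le (Set.ncard_le_ncard inter_subset_right hL),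
      Nat.lt_succ_of_le (Set.ncard_le_ncard inter_subset_right hF)⟩
  rw [Set.ncard_eq_toFinset_card T hT, Finset.card_eq_sum_card_fiberwise hmaps, hSdef, Finset.sum_product]
  refine Finset.sum_congr rfl fun k hk => Finset.sum_congr rfl fun a ha => ?_
  have hcoe : ((hT.toFinset.filter fun A => f A = (k, a) : Finset (Set α)) : Set (Set α))
      = {A : Set α | A ∈ T ∧ f A = (k, a)} := by
    ext A; simp [Set.Finite.mem_toFinset]
  rw [← Set.ncard_coe_finset, hcoe]
  by_cases hP : P k a
  · rw [if_pos hP, ← ncard_fibre hL hF hLF k a]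
    congr 1
    ext A
    simp only [mem_setOf_eq, hTdef, hfdef, Prod.mk.injEq]
    constructor
    · rintro ⟨⟨hAE, -⟩, hk, ha⟩; exact ⟨hAE, hk, ha⟩
    · rintro ⟨hAE, hk, ha⟩; exact ⟨⟨hAE, by rw [hk, ha]; exact hP⟩, hk, ha⟩
  · rw [if_neg hP]
    have : {A : Set α | A ∈ T ∧ f A = (k, a)} = ∅ := by
      rw [Set.eq_empty_iff_forall_notMem]
      rintro A ⟨⟨-, hPA⟩, hfA⟩
      simp only [hfdef, Prod.mk.injEq] at hfA
      exact hP (hfA.1 ▸ hfA.2 ▸ hPA)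
    rw [this, Set.ncard_empty]

/-! ### The two double sums evaluated -/

/-- The inner sum of the `U`-count at a fixed `k`: exactly one `a` survives. -/
lemma sum_range_ite_eq_single (m c q : ℕ) (hqm : q - c ≤ m) (f : ℕ → ℕ) :
    ∑ a ∈ range (m + 1), (if m - a = q - c then f a else 0) = f (m - (q - c)) := by
  rw [Finset.sum_ite, Finset.sum_const_zero, add_zero]
  have hfilt : (range (m + 1)).filter (fun a => m - a = q - c) = {m - (q - c)} := by
    ext a
    simp only [Finset.mem_filter, Finset.mem_range, Finset.mem_singleton]
    omega
  rw [hfilt, Finset.sum_singleton]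

/-- **The `U`-count evaluated**: `Σ_{k ≤ 3} Σ_{a ≤ m} [ρ(A) = p ∧ ρ(E∖A) = q]·C(3,k)·C(m,a) = 4C(m,q−2) + 3C(m,q−1) + C(m,q)`
for `q ≥ 2`, `p ≥ q + 2`, `m ≥ p + q − 2` (`ρ` through the fibre `(k, a)`). -/
lemma sumU (m p q : ℕ) (hq : 2 ≤ q) (hpq : q + 2 ≤ p) (hm : p + q - 2 ≤ m) :
    ∑ k ∈ range 4, ∑ a ∈ range (m + 1),
        (if min p (min k 2 + a) = p ∧ min p (min (3 - k) 2 + (m - a)) = q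
          then Nat.choose 3 k * m.choose a else 0)
      = 4 * m.choose (q - 2) + 3 * m.choose (q - 1) + m.choose q := by
  have key : ∀ k ∈ range 4, ∀ a ∈ range (m + 1),
      (min p (min k 2 + a) = p ∧ min p (min (3 - k) 2 + (m - a)) = q) ↔ m - a = q - min (3 - k) 2 := by
    intro k hk a ha
    rw [Finset.mem_range] at hk ha
    constructor <;> intro h <;> omega
  have e : ∀ k ∈ range 4, ∑ a ∈ range (m + 1),
      (if min p (min k 2 + a) = p ∧ min p (min (3 - k) 2 + (m - a)) = q
        then Nat.choose 3 k * m.choose a else 0)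
      = Nat.choose 3 k * m.choose (m - (q - min (3 - k) 2)) := by
    intro k hk
    rw [← sum_range_ite_eq_single m (min (3 - k) 2) q (by omega) (fun a => Nat.choose 3 k * m.choose a)]
    refine Finset.sum_congr rfl fun a ha => ?_
    rw [if_congr (key k hk a ha) rfl rfl]
  rw [Finset.sum_congr rfl e]
  simp only [Finset.sum_range_succ, Finset.sum_range_zero, zero_add]
  have s0 : m - (q - min (3 - 0) 2) = m - (q - 2) := by omega
  have s1 : m - (q - min (3 - 1) 2) = m - (q - 2) := by omega
  have s2 : m - (q - min (3 - 2) 2) = m - (q - 1) := by omega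
  have s3 : m - (q - min (3 - 3) 2) = m - q := by omega
  rw [s0, s1, s2, s3, Nat.choose_symm (by omega : q - 2 ≤ m), Nat.choose_symm (by omega : q - 1 ≤ m),
    Nat.choose_symm (by omega : q ≤ m)]
  simp only [Nat.choose_zero_right, Nat.choose_one_right, Nat.choose_self, show Nat.choose 3 2 = 3 from rfl]
  ring

/-- The inner sum of the `Y`-count at a fixed shift `c`: the `a` with `q < c + a < p`, as a partial row sum. -/
lemma sum_range_ite_Ico (m c p q : ℕ) :
    ∑ a ∈ range (m + 1), (if q < min p (c + a) ∧ min p (c + a) < p then m.choose a else 0)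
      = ∑ a ∈ Ico (q + 1 - c) (p - c), m.choose a := by
  rw [Finset.sum_ite, Finset.sum_const_zero, add_zero]
  refine Finset.sum_subset ?_ ?_
  · intro a ha
    simp only [Finset.mem_filter, Finset.mem_range] at ha
    rw [Finset.mem_Ico]; omega
  · intro a ha hnot
    simp only [Finset.mem_filter, Finset.mem_range, not_and] at hnot
    rw [Finset.mem_Ico] at ha
    by_cases ham : a < m + 1
    · exact absurd (by omega : min p (c + a) < p) (hnot ham (by omega))
    · exact Nat.choose_eq_zero_of_lt (by omega)

/-- **The `Y`-count evaluated**: `Σ_{k ≤ 3} Σ_{a ≤ m} [q < ρ(A) < p]·C(3,k)·C(m,a)` is the three-sum of `LineLadderArith`. -/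
lemma sumY (m p q : ℕ) (hq : 2 ≤ q) :
    ∑ k ∈ range 4, ∑ a ∈ range (m + 1),
        (if q < min p (min k 2 + a) ∧ min p (min k 2 + a) < p then Nat.choose 3 k * m.choose a else 0)
      = ∑ a ∈ Ico (q + 1) p, m.choose a + 3 * ∑ a ∈ Ico q (p - 1), m.choose a
          + 4 * ∑ a ∈ Ico (q - 1) (p - 2), m.choose a := by
  have e : ∀ k ∈ range 4, ∑ a ∈ range (m + 1),
      (if q < min p (min k 2 + a) ∧ min p (min k 2 + a) < p then Nat.choose 3 k * m.choose a else 0)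
      = Nat.choose 3 k * ∑ a ∈ Ico (q + 1 - min k 2) (p - min k 2), m.choose a := by
    intro k _
    rw [← sum_range_ite_Ico m (min k 2) p q, Finset.mul_sum]
    refine Finset.sum_congr rfl fun a _ => ?_
    split_ifs <;> simp
  rw [Finset.sum_congr rfl e]
  simp only [Finset.sum_range_succ, Finset.sum_range_zero, zero_add]
  have s0 : q + 1 - min 0 2 = q + 1 := by omega
  have s0' : p - min 0 2 = p := by omega
  have s1 : q + 1 - min 1 2 = q := by omega
  have s1' : p - min 1 2 = p - 1 := by omega
  have s2 : q + 1 - min 2 2 = q - 1 := by omega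
  have s2' : p - min 2 2 = p - 2 := by omega
  have s3 : q + 1 - min 3 2 = q - 1 := by omega
  have s3' : p - min 3 2 = p - 2 := by omega
  rw [s0, s0', s1, s1', s2, s2', s3, s3']
  simp only [Nat.choose_zero_right, Nat.choose_one_right, Nat.choose_self, show Nat.choose 3 2 = 3 from rfl]
  ring

/-! ### The bridge: any matroid with the line ladder's rank function satisfies C-025 at `(p, q)` -/

/-- The complement's fibre coordinates: `|(E ∖ A) ∩ L| = |L| − |A ∩ L|` for `L ⊆ E`, `A ⊆ E`. -/
lemma ncard_compl_inter {E L A : Set α} (hL : L.Finite) (hLE : L ⊆ E) :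
    ((E \ A) ∩ L).ncard = L.ncard - (A ∩ L).ncard := by
  have h1 : (E \ A) ∩ L = L \ A := by
    ext x; simp only [mem_inter_iff, mem_sdiff]
    exact ⟨fun h => ⟨h.2, h.1.2⟩, fun h => ⟨⟨hLE h.1, h.2⟩, h.1⟩⟩
  have h2 := Set.ncard_inter_add_ncard_sdiff_eq_ncard L A hL
  rw [h1, inter_comm]; omega

/-- **C-025 on the line ladder** (the bridge of `proofs/P9-S4-LINELADDER-g13.md` Lemma 1): a finite matroid `M` on
`E = L ⊔ F` with `|L| = 3`, `|F| = m` and rank function `ρ(X) = min p (min |X ∩ L| 2 + |X ∩ F|)` — the line ladder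
`T_p(U_{2,3} ⊕ U_{m,m})` — satisfies `RLS M p q` for every `q ≥ 2`, `p ≥ q + 2`, `m ≥ p + q − 2`. -/
theorem rls_of_eRk_lineLadder (M : Matroid α) [M.Finite] {L F : Set α} (hE : M.E = L ∪ F)
    (hLF : Disjoint L F) (hL3 : L.ncard = 3) {m p q : ℕ} (hFm : F.ncard = m)
    (hrk : ∀ X ⊆ M.E, M.eRk X = ((min p (min (X ∩ L).ncard 2 + (X ∩ F).ncard) : ℕ) : ℕ∞))
    (hq : 2 ≤ q) (hpq : q + 2 ≤ p) (hm : p + q - 2 ≤ m) : ThmN.RLS M p q := by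
  classical
  have hEfin : (L ∪ F).Finite := hE ▸ M.ground_finite
  have hL : L.Finite := hEfin.subset subset_union_left
  have hF : F.Finite := hEfin.subset subset_union_right
  have hLE : L ⊆ M.E := hE ▸ subset_union_left
  have hFE : F ⊆ M.E := hE ▸ subset_union_right
  -- the two level sets as fibre families
  have hU : {A : Set α | A ⊆ M.E ∧ M.eRk A = (p : ℕ∞) ∧ M.eRk (M.E \ A) = (q : ℕ∞)}
      = {A : Set α | A ⊆ L ∪ F ∧ (fun k a => min p (min k 2 + a) = p ∧ min p (min (3 - k) 2 + (m - a)) = q)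
          (A ∩ L).ncard (A ∩ F).ncard} := by
    ext A
    simp only [mem_setOf_eq]
    constructor
    · rintro ⟨hAE, h1, h2⟩
      rw [hrk A hAE, Nat.cast_inj] at h1
      rw [hrk (M.E \ A) sdiff_subset, Nat.cast_inj, ncard_compl_inter hL hLE, ncard_compl_inter hF hFE,
        hL3, hFm] at h2
      exact ⟨hE ▸ hAE, h1, h2⟩
    · rintro ⟨hAE, h1, h2⟩
      have hAE' : A ⊆ M.E := hE ▸ hAE
      refine ⟨hAE', ?_, ?_⟩
      · rw [hrk A hAE', Nat.cast_inj]; exact h1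
      · rw [hrk (M.E \ A) sdiff_subset, Nat.cast_inj, ncard_compl_inter hL hLE, ncard_compl_inter hF hFE,
          hL3, hFm]; exact h2
  have hY : {A : Set α | A ⊆ M.E ∧ (q : ℕ∞) < M.eRk A ∧ M.eRk A < (p : ℕ∞)}
      = {A : Set α | A ⊆ L ∪ F ∧ (fun k a => q < min p (min k 2 + a) ∧ min p (min k 2 + a) < p)
          (A ∩ L).ncard (A ∩ F).ncard} := by
    ext A
    simp only [mem_setOf_eq]
    constructor
    · rintro ⟨hAE, h1, h2⟩
      rw [hrk A hAE, Nat.cast_lt] at h1 h2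
      exact ⟨hE ▸ hAE, h1, h2⟩
    · rintro ⟨hAE, h1, h2⟩
      have hAE' : A ⊆ M.E := hE ▸ hAE
      refine ⟨hAE', ?_, ?_⟩
      · rw [hrk A hAE', Nat.cast_lt]; exact h1
      · rw [hrk A hAE', Nat.cast_lt]; exact h2
  unfold ThmN.RLS
  rw [hU, hY,
    ncard_setOf_fibre hL hF hLF (fun k a => min p (min k 2 + a) = p ∧ min p (min (3 - k) 2 + (m - a)) = q),
    ncard_setOf_fibre hL hF hLF (fun k a => q < min p (min k 2 + a) ∧ min p (min k 2 + a) < p), hL3, hFm,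
    sumU m p q hq hpq hm, sumY m p q hq]
  exact ladder_ineq p q m hq hpq hm

/-! ### The line ladder itself: `T_p(U_{2,3} ⊕ U_{m,m})` from Mathlib's `freeOn` / `disjointSum` and typer-2's `truncate` -/

/-- The rank of a disjoint sum on a subset of its ground set: `ρ(X) = ρ_M(X ∩ E_M) + ρ_N(X ∩ E_N)`. -/
lemma disjointSum_eRk_eq {M N : Matroid α} (h : Disjoint M.E N.E) {X : Set α} (hX : X ⊆ M.E ∪ N.E) :
    (M.disjointSum N h).eRk X = M.eRk (X ∩ M.E) + N.eRk (X ∩ N.E) := by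
  obtain ⟨I, hI⟩ := M.exists_isBasis (X ∩ M.E) inter_subset_right
  obtain ⟨J, hJ⟩ := N.exists_isBasis (X ∩ N.E) inter_subset_right
  have hIM : I ⊆ M.E := hI.subset.trans inter_subset_right
  have hJN : J ⊆ N.E := hJ.subset.trans inter_subset_right
  have hIJ : Disjoint I J := h.mono hIM hJN
  have hB : (M.disjointSum N h).IsBasis (I ∪ J) X := by
    rw [Matroid.disjointSum_isBasis_iff]
    refine ⟨?_, ?_, union_subset (hI.subset.trans inter_subset_left) (hJ.subset.trans inter_subset_left), hX⟩
    · have e : (I ∪ J) ∩ M.E = I := by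
        rw [union_inter_distrib_right, inter_eq_left.2 hIM, (h.symm.mono_left hJN).inter_eq, union_empty]
      rw [e]; exact hI
    · have e : (I ∪ J) ∩ N.E = J := by
        rw [union_inter_distrib_right, (h.mono_left hIM).inter_eq, inter_eq_left.2 hJN, empty_union]
      rw [e]; exact hJ
  rw [← hB.encard_eq_eRk, Set.encard_union_eq hIJ, hI.encard_eq_eRk, hJ.encard_eq_eRk]

/-- `freeOn L` is finite when `L` is. -/
theorem freeOn_finite {L : Set α} (hL : L.Finite) : (Matroid.freeOn L).Finite :=
  ⟨by rwa [Matroid.freeOn_ground]⟩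

/-- The ground sets of the two blocks are disjoint. -/
theorem blocks_disjoint {L F : Set α} (hL : L.Finite) (hLF : Disjoint L F) :
    Disjoint (@PercRepro.Matroid.truncate α (Matroid.freeOn L) (freeOn_finite hL) 2).E (Matroid.freeOn F).E := by
  rw [PercRepro.Matroid.truncate_ground, Matroid.freeOn_ground, Matroid.freeOn_ground]; exact hLF

/-- The block sum `U_{2,3} ⊕ U_{m,m}` (before the truncation to rank `p`) is finite. -/
theorem blockSum_finite {L F : Set α} (hL : L.Finite) (hF : F.Finite) (hLF : Disjoint L F) :
    ((@PercRepro.Matroid.truncate α (Matroid.freeOn L) (freeOn_finite hL) 2).disjointSum (Matroid.freeOn F)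
      (blocks_disjoint hL hLF)).Finite := by
  refine ⟨?_⟩
  rw [Matroid.disjointSum_ground_eq, PercRepro.Matroid.truncate_ground, Matroid.freeOn_ground,
    Matroid.freeOn_ground]
  exact hL.union hF

/-- **The rank function of the line ladder** `T_p(U_{2,3} ⊕ U_{m,m})`: for `X ⊆ L ∪ F`,
`ρ(X) = min p (min |X ∩ L| 2 + |X ∩ F|)`. -/
theorem lineLadder_eRk {L F : Set α} (hL : L.Finite) (hF : F.Finite) (hLF : Disjoint L F) (p : ℕ) {X : Set α}
    (hX : X ⊆ L ∪ F) :
    (@PercRepro.Matroid.truncate α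
        ((@PercRepro.Matroid.truncate α (Matroid.freeOn L) (freeOn_finite hL) 2).disjointSum (Matroid.freeOn F)
          (blocks_disjoint hL hLF)) (blockSum_finite hL hF hLF) p).eRk X
      = ((min p (min (X ∩ L).ncard 2 + (X ∩ F).ncard) : ℕ) : ℕ∞) := by
  rw [PercRepro.Matroid.truncate_eRk, disjointSum_eRk_eq _ (by
      rwa [PercRepro.Matroid.truncate_ground, Matroid.freeOn_ground, Matroid.freeOn_ground]),
    PercRepro.Matroid.truncate_ground, Matroid.freeOn_ground, Matroid.freeOn_ground,
    PercRepro.Matroid.truncate_eRk, Matroid.eRk_freeOn inter_subset_right, Matroid.eRk_freeOn inter_subset_right,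
    ← (hL.subset inter_subset_right).cast_ncard_eq, ← (hF.subset inter_subset_right).cast_ncard_eq]
  simp only [Nat.cast_add, Nat.mono_cast.map_min, Nat.cast_ofNat]
  rw [min_comm]

/-- **C-025 ON THE LINE LADDER** `T_p(U_{2,3} ⊕ U_{m,m})` — the theorem of `proofs/P9-S4-LINELADDER-g13.md` in the
tree: for a 3-point set `L` and an `m`-point set `F` disjoint from it, the matroid `T_p((T_2 (freeOn L)) ⊕ freeOn F)`
(a 3-point line plus `m` points in general position, truncated to rank `p`) satisfies `RLS` at `(p, q)` for every
`q ≥ 2`, `p ≥ q + 2` and `m ≥ p + q − 2` (the other `m` are the tight layer and below, Theorem M / `U = ∅`). -/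
theorem rls_lineLadder {L F : Set α} (hL : L.Finite) (hF : F.Finite) (hLF : Disjoint L F) (hL3 : L.ncard = 3)
    {m p q : ℕ} (hFm : F.ncard = m) (hq : 2 ≤ q) (hpq : q + 2 ≤ p) (hm : p + q - 2 ≤ m) :
    @ThmN.RLS α (@PercRepro.Matroid.truncate α
        ((@PercRepro.Matroid.truncate α (Matroid.freeOn L) (freeOn_finite hL) 2).disjointSum (Matroid.freeOn F)
          (blocks_disjoint hL hLF)) (blockSum_finite hL hF hLF) p)
      (@PercRepro.Matroid.truncate_finite α _ (blockSum_finite hL hF hLF) p) p q := by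
  refine rls_of_eRk_lineLadder _ ?_ hLF hL3 hFm (fun X hX => lineLadder_eRk hL hF hLF p ?_) hq hpq hm
  · rw [PercRepro.Matroid.truncate_ground, Matroid.disjointSum_ground_eq, PercRepro.Matroid.truncate_ground,
      Matroid.freeOn_ground, Matroid.freeOn_ground]
  · rwa [PercRepro.Matroid.truncate_ground, Matroid.disjointSum_ground_eq, PercRepro.Matroid.truncate_ground,
      Matroid.freeOn_ground, Matroid.freeOn_ground] at hX

end PercRepro.LineLadder
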